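/-
Copyright (c) 2026 the pub-hodgecm-mathlib formalisation cell (harness21).  Prover seat hodgecm-mathlib-K2Liu-p07 (g3), Track B «K2-LIT»,
#184♮ = hLiu418 = `stmt-HodgeConjecture-24832`; #42S payer road, organ S1 (local Siegel–Weil spanning), ROAD W letter (R-c), `Ad(d_a)` part
(LEAD F0P6-plan (g14) BATCH #16 (2) «(R-c) … the `Ad_{d_a}` letters `a(Ad x) = a(x)`, `c(Ad x) = a_v⁻¹·c(x)` = p07»).
-/
import Summits.HodgeConjecture.HodgeConjecture.Theorems.K2LiuDeltaSpTransportAdaptedBlocks    -- ★ A2d-2: the master formula `deltaTransport_iotaD_apply`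
import Summits.HodgeConjecture.HodgeConjecture.Theorems.K2LiuLocalSWRamifiedRelativeSign      -- ★ F7r-1 §3 (+ ★ A1): the adapted blocks of `Ad(d_a) h`
import HarnessLib

/-!
# Crux `HLiu418`, #42S organ S1, ROAD W, letter (R-c), `Ad(d_a)` part: IN THE `Δ`-MODEL, `Ad(d_a)` KEEPS THE LEVI LETTER AND RESCALES THE UNIPOTENT LETTER —
# `σ′(Ad_{d_a} h) = m(a, d) · n(a_v⁻¹ • b)` whenever `σ′(h) = m(a, d) · n(b)` (`h ∈ P_Δ`)

Cell `hodgecm-mathlib`, crux item hLiu418 = `stmt-HodgeConjecture-24832`; squad K2 ∕ K2Liu; LEAD F0P6-plan (g14), organ lead K2Liu-p06 (g4);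
prover K2Liu-p07 (g3).  THEOREMS ONLY (no `def`, no instance, no notation, no named-fact hypothesis, no `sorry`); lane
`--supports stmt-HodgeConjecture-24832 --as helper`.

WHY.  Hypothesis (d) of ★ F7r-4 `middleCell_comp_eq` (the ramified witness' middle cell) compares `F(w₁ · Ad_{d_a} x)` with `F(w₁ · x)` for `x ∈ P_Δ`; in the
doubling-polarised (`Δ`-) model the Weil operator of `x ∈ P_Δ` is `c • (leviEquivSB a ∘ unipotentEquivSB q_b)` over the Siegel letters `σ′(x) = m(a,d)·n(b)`
(★ A2d `exists_deltaTransport_iotaD_eq_leviSp_mul_unipotentSp`, ★ junction `exists_toRep_transport_eq_smul_levi_unipotent`).  This file proves that the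
letters of `Ad_{d_a} x` are `(a, d, a_v⁻¹ • b)` — the SAME Levi letter and the unipotent letter rescaled by the unit `a_v⁻¹` — by the MASTER FORMULA
(★ `deltaTransport_iotaD_apply`: `σ′(h)(R b, R a) = (R(C a + D b), R(A a + B b))` in the adapted blocks `(A, B; C, D)` of `h`) and the adapted blocks of
`Ad_{d_a} h`: `(A, a⁻¹B; aC, D)` (★ F5′-A1 `adapt_matA_localCongr_dA`, ★ F7r-1 `blkB_matA_localCongr_dA`, `blkD_matA_localCongr_dA`).  With ★ (R-c)
`K2LiuLatticePairMiddleProfile.forall_ball_mul_unit_iff` this is the dilation invariance (d), once the frame bridge (R-b) reads `w₁` in the block datum.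
* `glue_re_im_add`, `glue_re_im_smul` — the real frame `R` is `F_v`-linear;  `deltaTransport_iotaD_localCongr_dA_apply` — the master formula for `Ad_{d_a} h`;
* **`deltaTransport_iotaD_localCongr_dA_eq_leviSp_mul_unipotentSp`** — the head.
References: [Weil1964] n° 6, p. 151; [Kudla1994] §3; [MoeglinVignerasWaldspurger1987] Chap. 2 II.6; [HarrisKudlaSweet1996] §1 (1.11).
HONEST LABEL.  Count-neutral helper: `HC_CM` is proved only modulo the 7 printed citations (2 remaining named inputs: hLiu418 = `stmt-HodgeConjecture-24832`,
h413 = `stmt-HodgeConjecture-24833`) until rung 0 closes.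
-/

set_option autoImplicit false
set_option linter.dupNamespace false -- the mandated namespace repeats `HodgeConjecture.HodgeConjecture`

noncomputable section

open scoped Matrix
open NumberField IsDedekindDomain Matrix
open Literature.RepresentationTheory.HeisenbergGroup Literature.RepresentationTheory.HeisenbergGroup.SymplecticMatrix
open Literature.NumberTheory.Automorphic Literature.NumberTheory.Automorphic.UnitaryGroup
open Literature.NumberTheory.Automorphic.UnitaryGroup.QuadraticCoordinates
open Literature.NumberTheory.GelbartRogawski1991 Literature.NumberTheory.GelbartRogawski1991.AdaptedBlocks
open Literature.NumberTheory.GelbartRogawski1991.UnitaryDualPair.LocalSplitting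
open Summit.HodgeConjecture.HodgeConjecture.Cruxes.HLiu418.K2LiuDeltaSpTransportAdaptedBlocks
open Summit.HodgeConjecture.HodgeConjecture.Cruxes.HLiu418.K2LiuLocalSWSimilitudeAlgebra
open Summit.HodgeConjecture.HodgeConjecture.Cruxes.HLiu418.K2LiuLocalSWRamifiedRelativeSign

namespace Summit.HodgeConjecture.HodgeConjecture.Cruxes.HLiu418.K2LiuDeltaSpTransportAdLetters

variable (F : Type) [Field F] [NumberField F] (E : Type) [Field E] [NumberField E] [Algebra F E]
  [Algebra.IsQuadraticExtension F E] (c : E ≃ₐ[F] E)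
  {δ : E} (hcδ : c δ = -δ) (hδ : δ ≠ 0) {d : F} (hd : δ * δ = algebraMap F E d)
  (v : HeightOneSpectrum (𝓞 F)) (n : ℕ) {T₀ : Matrix (Fin n) (Fin n) F} (hT₀ : T₀.IsSymm) (hT₀d : IsUnit T₀.det)
  {JD : Matrix (Fin (n + n)) (Fin (n + n)) E} (hJD : JD = (gramD F n T₀).map (algebraMap F E))

/-! ## §1 The real frame `R b = glue e₂ (re ∘ b) (im ∘ b)` is `F_v`-linear -/

/-- `R (b + b′) = R b + R b′`. [folklore] -/
theorem glue_re_im_add (b b' : Fin n → LocalRing E v) :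
    glue (e₂ n) (fun i => re (quadraticLocalEquiv E v c hcδ hδ).toLinearEquiv.toAddEquiv ((b + b') i))
        (fun i => im (quadraticLocalEquiv E v c hcδ hδ).toLinearEquiv.toAddEquiv ((b + b') i)) =
      glue (e₂ n) (fun i => re (quadraticLocalEquiv E v c hcδ hδ).toLinearEquiv.toAddEquiv (b i))
          (fun i => im (quadraticLocalEquiv E v c hcδ hδ).toLinearEquiv.toAddEquiv (b i)) +
        glue (e₂ n) (fun i => re (quadraticLocalEquiv E v c hcδ hδ).toLinearEquiv.toAddEquiv (b' i))
          (fun i => im (quadraticLocalEquiv E v c hcδ hδ).toLinearEquiv.toAddEquiv (b' i)) := by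
  rw [glue_add]
  congr 1 <;> funext i <;> simp only [Pi.add_apply, map_add]

/-- `R (ι(t) · b) = t • R b` for `t ∈ F_v` (`re`, `im` are `F_v`-linear). [folklore] -/
theorem glue_re_im_smul (t : v.adicCompletion F) (b : Fin n → LocalRing E v) :
    glue (e₂ n) (fun i => re (quadraticLocalEquiv E v c hcδ hδ).toLinearEquiv.toAddEquiv ((toLocalRing E v t • b) i))
        (fun i => im (quadraticLocalEquiv E v c hcδ hδ).toLinearEquiv.toAddEquiv ((toLocalRing E v t • b) i)) =
      t • glue (e₂ n) (fun i => re (quadraticLocalEquiv E v c hcδ hδ).toLinearEquiv.toAddEquiv (b i))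
          (fun i => im (quadraticLocalEquiv E v c hcδ hδ).toLinearEquiv.toAddEquiv (b i)) := by
  have hre : ∀ z : LocalRing E v, re (quadraticLocalEquiv E v c hcδ hδ).toLinearEquiv.toAddEquiv (toLocalRing E v t * z) =
      t * re (quadraticLocalEquiv E v c hcδ hδ).toLinearEquiv.toAddEquiv z := fun z => by
    rw [← smul_localRing_def, re_def, re_def]
    change ((quadraticLocalEquiv E v c hcδ hδ).toLinearEquiv.symm (t • z)).1 = t * ((quadraticLocalEquiv E v c hcδ hδ).toLinearEquiv.symm z).1
    rw [LinearEquiv.map_smul, Prod.smul_fst, smul_eq_mul]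
  have him : ∀ z : LocalRing E v, im (quadraticLocalEquiv E v c hcδ hδ).toLinearEquiv.toAddEquiv (toLocalRing E v t * z) =
      t * im (quadraticLocalEquiv E v c hcδ hδ).toLinearEquiv.toAddEquiv z := fun z => by
    rw [← smul_localRing_def, im_def, im_def]
    change ((quadraticLocalEquiv E v c hcδ hδ).toLinearEquiv.symm (t • z)).2 = t * ((quadraticLocalEquiv E v c hcδ hδ).toLinearEquiv.symm z).2
    rw [LinearEquiv.map_smul, Prod.smul_snd, smul_eq_mul]
  funext k
  obtain ⟨s, rfl⟩ := (e₂ n).surjective k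
  rcases s with i | i
  · simp only [glue_apply_inl, Pi.smul_apply, smul_eq_mul, hre]
  · simp only [glue_apply_inr, Pi.smul_apply, smul_eq_mul, him]

/-! ## §2 The master formula for `Ad(d_a) h` -/

variable (a : Fˣ) {D₀ : GL (Fin (n + n)) F}
  (hD₀ : (D₀ : Matrix (Fin (n + n)) (Fin (n + n)) F) =
    Matrix.reindex (e₂ n) (e₂ n) (cayR F (Fin n) * Matrix.fromBlocks 1 0 0 ((a : F) • (1 : Matrix (Fin n) (Fin n) F)) * cayRinv F (Fin n)))
  {DA : GL (Fin (n + n)) E} (hDA : DA = Matrix.GeneralLinearGroup.map (algebraMap F E) D₀)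
  {b₀ : E} (hb₀ : b₀ ≠ 0) (hDAJ : formCongr (c : E →+* E) DA (b₀ • JD) = JD)

include hD₀ hDA in
/-- **THE MASTER FORMULA FOR `Ad(d_a) h`**: `σ′(Ad_{d_a} h)(R b, R a′) = (R(ι(a)·C a′ + D b), R(A a′ + ι(a⁻¹)·B b))` — the adapted blocks of `Ad_{d_a} h` are `(A, a⁻¹B; aC, D)`.
[cite: Kudla1994, §3] [cite: HarrisKudlaSweet1996, §1 (1.11)] -/
theorem deltaTransport_iotaD_localCongr_dA_apply (h : UnitaryGroup.localPi E c (n + n) JD v) (a' b : Fin n → LocalRing E v) :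
    ((deltaSymplecticTransport (e₂ n) (T₀.map (algebraMap F (v.adicCompletion F))) (localGram_gramD F v n (T₀ := T₀))
        (iotaD F E c hcδ hδ hd v n hT₀ hJD (localCongr E c DA hb₀ hDAJ v h)) :
        symplecticGroup (polar (Matrix.toLinearMap₂' (v.adicCompletion F) (deltaGram (e₂ n) (T₀.map (algebraMap F (v.adicCompletion F))))))) :
        ((Fin (n + n) → v.adicCompletion F) × (Fin (n + n) → v.adicCompletion F)) ≃ₗ[v.adicCompletion F]
          ((Fin (n + n) → v.adicCompletion F) × (Fin (n + n) → v.adicCompletion F)))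
      (glue (e₂ n) (fun i => re (quadraticLocalEquiv E v c hcδ hδ).toLinearEquiv.toAddEquiv (b i))
          (fun i => im (quadraticLocalEquiv E v c hcδ hδ).toLinearEquiv.toAddEquiv (b i)),
        glue (e₂ n) (fun i => re (quadraticLocalEquiv E v c hcδ hδ).toLinearEquiv.toAddEquiv (a' i))
          (fun i => im (quadraticLocalEquiv E v c hcδ hδ).toLinearEquiv.toAddEquiv (a' i))) =
      (glue (e₂ n) (fun i => re (quadraticLocalEquiv E v c hcδ hδ).toLinearEquiv.toAddEquiv
            ((((toLocalRing E v ((a : F) : v.adicCompletion F)) • blkC (matA F E c v n h)) *ᵥ a' + blkD (matA F E c v n h) *ᵥ b) i))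
          (fun i => im (quadraticLocalEquiv E v c hcδ hδ).toLinearEquiv.toAddEquiv
            ((((toLocalRing E v ((a : F) : v.adicCompletion F)) • blkC (matA F E c v n h)) *ᵥ a' + blkD (matA F E c v n h) *ᵥ b) i)),
        glue (e₂ n) (fun i => re (quadraticLocalEquiv E v c hcδ hδ).toLinearEquiv.toAddEquiv
            ((blkA (matA F E c v n h) *ᵥ a' + ((toLocalRing E v (((a⁻¹ : Fˣ) : F) : v.adicCompletion F)) • blkB (matA F E c v n h)) *ᵥ b) i))
          (fun i => im (quadraticLocalEquiv E v c hcδ hδ).toLinearEquiv.toAddEquiv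
            ((blkA (matA F E c v n h) *ᵥ a' + ((toLocalRing E v (((a⁻¹ : Fˣ) : F) : v.adicCompletion F)) • blkB (matA F E c v n h)) *ᵥ b) i))) := by
  rw [deltaTransport_iotaD_apply, blkA_matA_localCongr_dA F E c v n a hD₀ hDA hb₀ hDAJ, blkB_matA_localCongr_dA F E c v n a hD₀ hDA hb₀ hDAJ,
    blkC_matA_localCongr_dA F E c v n a hD₀ hDA hb₀ hDAJ, blkD_matA_localCongr_dA F E c v n a hD₀ hDA hb₀ hDAJ]

/-! ## §3 The letters of `Ad(d_a) h`, `h ∈ P_Δ`: same Levi letter, unipotent letter rescaled by `a_v⁻¹` -/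

set_option maxHeartbeats 400000 in -- measured: 200000 times out at `isDefEq` on the two `deltaSymplecticTransport (iotaD …)` telescopes, 400000 passes
include hD₀ hDA hT₀ in
/-- **`σ′(Ad_{d_a} h) = m(a, d) · n(a_v⁻¹ • b)` WHENEVER `σ′(h) = m(a, d) · n(b)`** (`h ∈ P_Δ`; any Levi∕unipotent letters `(a, d, b)` of `h`, e.g. those of ★ A2d
`exists_deltaTransport_iotaD_eq_leviSp_mul_unipotentSp`): `Ad(d_a)` does not move the Levi letter and multiplies the unipotent letter by the unit `a_v⁻¹ = ι_v(a)⁻¹` —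
the `Δ`-model form of `Ad(d_a) m = m`, `Ad(d_a) n(t) = n(a⁻¹t)` (★ F7r-4, ★ C1 `localCongr_dA_nElem`). [cite: Weil1964, n° 6, p. 151] [cite: Kudla1994, §3]
[cite: HarrisKudlaSweet1996, §1 (1.11)] -/
theorem deltaTransport_iotaD_localCongr_dA_eq_leviSp_mul_unipotentSp (h : UnitaryGroup.localPi E c (n + n) JD v)
    (hh : IsSiegelDelta F E c hcδ hδ hd v n hT₀ hJD h)
    {a₁ d₁ : (Fin (n + n) → v.adicCompletion F) ≃ₗ[v.adicCompletion F] (Fin (n + n) → v.adicCompletion F)}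
    {had : ∀ x y : Fin (n + n) → v.adicCompletion F,
      Matrix.toLinearMap₂' (v.adicCompletion F) (deltaGram (e₂ n) (T₀.map (algebraMap F (v.adicCompletion F)))) (a₁ x) (d₁ y) =
        Matrix.toLinearMap₂' (v.adicCompletion F) (deltaGram (e₂ n) (T₀.map (algebraMap F (v.adicCompletion F)))) x y}
    {b₁ : (Fin (n + n) → v.adicCompletion F) →ₗ[v.adicCompletion F] (Fin (n + n) → v.adicCompletion F)}
    {hb₁ : ∀ x x' : Fin (n + n) → v.adicCompletion F,
      Matrix.toLinearMap₂' (v.adicCompletion F) (deltaGram (e₂ n) (T₀.map (algebraMap F (v.adicCompletion F)))) x (b₁ x') =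
        Matrix.toLinearMap₂' (v.adicCompletion F) (deltaGram (e₂ n) (T₀.map (algebraMap F (v.adicCompletion F)))) x' (b₁ x)}
    (heq : deltaSymplecticTransport (e₂ n) (T₀.map (algebraMap F (v.adicCompletion F))) (localGram_gramD F v n (T₀ := T₀))
        (iotaD F E c hcδ hδ hd v n hT₀ hJD h) = leviSp _ a₁ d₁ had * unipotentSp _ b₁ hb₁) :
    deltaSymplecticTransport (e₂ n) (T₀.map (algebraMap F (v.adicCompletion F))) (localGram_gramD F v n (T₀ := T₀))
        (iotaD F E c hcδ hδ hd v n hT₀ hJD (localCongr E c DA hb₀ hDAJ v h)) =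
      leviSp _ a₁ d₁ had * unipotentSp _ (((((a⁻¹ : Fˣ) : F) : v.adicCompletion F)) • b₁)
        (fun x x' => by rw [LinearMap.smul_apply, LinearMap.smul_apply, map_smul, map_smul, hb₁]) := by
  have hC : blkC (matA F E c v n h) = 0 := (isSiegelDelta_iff_blkC_eq_zero F E c hcδ hδ hd v n hT₀ hJD h).1 hh
  have hg0 : glue (e₂ n) (fun _ : Fin n => (0 : v.adicCompletion F)) (fun _ : Fin n => (0 : v.adicCompletion F)) = 0 := glue_zero (e₂ n)
  -- the generators evaluated
  have hRHS : ∀ (b : (Fin (n + n) → v.adicCompletion F) →ₗ[v.adicCompletion F] (Fin (n + n) → v.adicCompletion F))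
      (hb : ∀ x x' : Fin (n + n) → v.adicCompletion F,
        Matrix.toLinearMap₂' (v.adicCompletion F) (deltaGram (e₂ n) (T₀.map (algebraMap F (v.adicCompletion F)))) x (b x') =
          Matrix.toLinearMap₂' (v.adicCompletion F) (deltaGram (e₂ n) (T₀.map (algebraMap F (v.adicCompletion F)))) x' (b x))
      (x y : Fin (n + n) → v.adicCompletion F),
      ((leviSp _ a₁ d₁ had * unipotentSp _ b hb :
        symplecticGroup (polar (Matrix.toLinearMap₂' (v.adicCompletion F) (deltaGram (e₂ n) (T₀.map (algebraMap F (v.adicCompletion F))))))) :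
        ((Fin (n + n) → v.adicCompletion F) × (Fin (n + n) → v.adicCompletion F)) ≃ₗ[v.adicCompletion F]
          ((Fin (n + n) → v.adicCompletion F) × (Fin (n + n) → v.adicCompletion F))) (x, y) = (a₁ x, d₁ (y + b x)) := fun b hb x y => by
    rw [Subgroup.coe_mul, LinearEquiv.mul_apply, coe_unipotentSp, unipotentσ_apply, coe_leviSp_apply]
  -- the letters of `h` on the real frame, read off `heq` through the master formula (`C = 0`)
  have ha₁ : ∀ bb : Fin n → LocalRing E v,
      a₁ (glue (e₂ n) (fun i => re (quadraticLocalEquiv E v c hcδ hδ).toLinearEquiv.toAddEquiv (bb i))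
          (fun i => im (quadraticLocalEquiv E v c hcδ hδ).toLinearEquiv.toAddEquiv (bb i))) =
        glue (e₂ n) (fun i => re (quadraticLocalEquiv E v c hcδ hδ).toLinearEquiv.toAddEquiv ((blkD (matA F E c v n h) *ᵥ bb) i))
          (fun i => im (quadraticLocalEquiv E v c hcδ hδ).toLinearEquiv.toAddEquiv ((blkD (matA F E c v n h) *ᵥ bb) i)) ∧
      d₁ (b₁ (glue (e₂ n) (fun i => re (quadraticLocalEquiv E v c hcδ hδ).toLinearEquiv.toAddEquiv (bb i))
          (fun i => im (quadraticLocalEquiv E v c hcδ hδ).toLinearEquiv.toAddEquiv (bb i)))) =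
        glue (e₂ n) (fun i => re (quadraticLocalEquiv E v c hcδ hδ).toLinearEquiv.toAddEquiv ((blkB (matA F E c v n h) *ᵥ bb) i))
          (fun i => im (quadraticLocalEquiv E v c hcδ hδ).toLinearEquiv.toAddEquiv ((blkB (matA F E c v n h) *ᵥ bb) i)) := by
    intro bb
    have h1 := deltaTransport_iotaD_apply F E c hcδ hδ hd v n hT₀ hJD h 0 bb
    rw [heq, hRHS, hC, Matrix.zero_mulVec, zero_add] at h1
    simp only [map_zero, Matrix.mulVec_zero, Pi.zero_apply, hg0, zero_add] at h1
    exact Prod.ext_iff.1 h1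
  have hd₁ : ∀ aa : Fin n → LocalRing E v,
      d₁ (glue (e₂ n) (fun i => re (quadraticLocalEquiv E v c hcδ hδ).toLinearEquiv.toAddEquiv (aa i))
          (fun i => im (quadraticLocalEquiv E v c hcδ hδ).toLinearEquiv.toAddEquiv (aa i))) =
        glue (e₂ n) (fun i => re (quadraticLocalEquiv E v c hcδ hδ).toLinearEquiv.toAddEquiv ((blkA (matA F E c v n h) *ᵥ aa) i))
          (fun i => im (quadraticLocalEquiv E v c hcδ hδ).toLinearEquiv.toAddEquiv ((blkA (matA F E c v n h) *ᵥ aa) i)) := by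
    intro aa
    have h1 := deltaTransport_iotaD_apply F E c hcδ hδ hd v n hT₀ hJD h aa 0
    rw [heq, hRHS, hC, Matrix.zero_mulVec, zero_add] at h1
    simp only [map_zero, Matrix.mulVec_zero, Pi.zero_apply, hg0, add_zero] at h1
    exact (Prod.ext_iff.1 h1).2
  -- compare the two group elements on all of `X_Δ × Y_Δ` through the real frame
  apply Subtype.ext
  apply LinearEquiv.ext
  rintro ⟨x, y⟩
  obtain ⟨bb, rfl⟩ := exists_eq_glue_re_im F E c hcδ hδ v n x
  obtain ⟨aa, rfl⟩ := exists_eq_glue_re_im F E c hcδ hδ v n y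
  have h2 := deltaTransport_iotaD_localCongr_dA_apply F E c hcδ hδ hd v n hT₀ hJD a hD₀ hDA hb₀ hDAJ h aa bb
  rw [hC, smul_zero, Matrix.zero_mulVec, zero_add, Matrix.smul_mulVec] at h2
  rw [h2, hRHS, LinearMap.smul_apply, map_add, LinearEquiv.map_smul, (ha₁ bb).1, (ha₁ bb).2, hd₁, glue_re_im_add, glue_re_im_smul]

end Summit.HodgeConjecture.HodgeConjecture.Cruxes.HLiu418.K2LiuDeltaSpTransportAdLetters
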